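import Literature.AlgebraicGeometry.Motives.HodgeLieWeightOneSl2CenterCommutator
import Literature.AlgebraicGeometry.Motives.HodgeLieWeightOneRankFourCube
import Literature.RepresentationTheory.GeneralLinear.SL2TripleCornerCommutant
import HarnessLib

/-!
# Weight-one Hodge structures whose Hodge Lie algebra has a three-dimensional derived algebra and ARBITRARY centre.
# C: the projector `π = α⁻¹(EF + FE)` onto the `𝔰𝔩₂`-part, its rationality `π = p_ℂ` with `p ∈ ℚ·𝔡²`, and `𝔷 p = 0`

Family `hodge`, layer `Literature/AlgebraicGeometry/Motives`; THEOREMS ONLY (no definition, no named fact; D-0026).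
Third abstract file of the lane MT-RANK-SIX-ISOGENY of the cell `pub-hodgecm2` (COR-CM), seat `b27` (setting as in
`Motives/HodgeLieWeightOneSl2Center`: polarizable weight-one `H`, polarization `ψ`, graded basis `e` with degrees in
`{0,1}`, `P = gradingEnd e deg`, `X ∈ 𝔥 ∖ End_Hdg(V)`, `E = P X_ℂ (1 − P)`, `F = (1 − P) X_ℂ P`, centre
`𝔷 = 𝔥 ∩ End_Hdg(V)`, derived algebra `𝔡 = span_ℚ {[X₁, X₂]}` of dimension `3`, and `[E, F] = α(2P−1) + ζ₀`, `α ≠ 0`,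
`ζ₀ ∈ 𝔷_ℂ`, `ζ₀E = ζ₀F = 0` from `Motives/HodgeLieWeightOneSl2CenterCommutator`).

* §4 `projector_identities` — for `π = α⁻¹(E F + F E)`: **`E F E = αE`, `F E F = αF`, `π² = π`, `Pπ = πP`,
  `Eπ = E = πE`, `Fπ = F = πF`, `E F = α Pπ`, `F E = α(π − Pπ)`, `π = 1 + α⁻¹ζ₀(2P−1)`, `ζ₀π = 0 = πζ₀`** — so
  `(P, E, F)` is an `𝔰𝔩₂`-triple in isotypic position on `range π` in the sense of
  `RepresentationTheory/GeneralLinear/SL2TripleCornerCommutant`, and `2P − 1 = −α⁻¹ζ₀` on `ker π`;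
  `sq_eq_smul_projector` — **`D² ∈ ℂπ` for every `D ∈ 𝔡_ℂ`** (`D = aE + bF + c[E,F]`, `D² = α(ab + αc²)π`).
* §5 `exists_rat_projector` — **`π = p_ℂ` for a RATIONAL idempotent `p = q⁻¹B²`, `B ∈ 𝔡`, `q ∈ ℚˣ`**: some `B ∈ 𝔡`
  has `B² ≠ 0` (otherwise the trace form would vanish on `𝔡`, against `hodgeLie_derived_trace_separating`), `B_ℂ² = λπ`
  with `λ ≠ 0`, and `B⁴ = λB²` makes `λ` rational; `p` is a `ψ`-symmetric Hodge endomorphism commuting with `𝔥`, with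
  `D p = D = p D` for `D ∈ 𝔡`.
* §6 `center_mul_projector_eq_zero` — **`Z p = 0` for every `Z ∈ 𝔷`**: the CORNER of the commutant of `{P, E, F}`
  at `π` consists (commutant descent `mem_span_baseChange_of_forall_commute`, and `[b, 2P−1]π = −α⁻¹[b, ζ₀]π = 0` for a
  rational `b` commuting with `𝔡`) of combinations of `b'_ℂ` with `b' = b p ∈ End_Hdg(V)`, which commute with `Z`; so
  `Z_ℂ π` is central in the corner, hence `Z_ℂ π = c π` (`exists_eq_smul_of_mem_center_corner_commutant`), `c ∈ ℚ`,
  and `c = 0` since `Z` is `ψ`-skew and `p` is `ψ`-symmetric with `p ≠ 0`.  Hence **`Z D = 0` for `Z ∈ 𝔷`, `D ∈ 𝔡`**: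
  the centre of `Lie Hg` kills the part of `V` on which the derived algebra acts.

Classically: `Hg⁰ = SL₂ · Z⁰` and a factor of the Hodge structure on which `SL₂` acts non-trivially carries no
non-trivial action of the central torus — for such a factor the Hodge cocharacter already factors through `SL₂ · 𝔾ₘ`
(Moonen–Zarhin 1999 §2 for `dim ≤ 5`; Deligne, LNM 900, I 3.4–3.7).  The sequel reads this on `End_Hdg(V)`.

## References

* [MoonenZarhin1999LowDim] B. Moonen, Yu. Zarhin, *Hodge classes on abelian varieties of low dimension*, Math. Ann. 315
  (1999), §2.
* [Deligne1982HodgeCycles] P. Deligne, *Hodge cycles on abelian varieties*, LNM 900 (1982), I §3 (3.1–3.7).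
* [Zarhin1983HodgeGroupsK3] Yu. G. Zarhin, *Hodge groups of K3 surfaces*, J. reine angew. Math. 341 (1983), §2
  (commutant descent).
* [FultonHarris1991] W. Fulton, J. Harris, *Representation Theory*, GTM 129 (1991), Lecture 11 (§11.1).
* [Huybrechts2016K3] D. Huybrechts, *Lectures on K3 Surfaces* (2016), Thm. 3.3.9 (proof, p. 67: `Hg ⊆ Sp(ψ)`).
-/

noncomputable section

open scoped TensorProduct

namespace Literature.AlgebraicGeometry.Motives

universe u

namespace HodgeStructure

open ProjectorBlocks Literature.RepresentationTheory.GeneralLinear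

variable {V : Type u} [AddCommGroup V] [Module ℚ V] [Module.Finite ℚ V] [HodgeTensorFacts.{u, u}] {n : ℤ}
  {S : Type u} [Fintype S] [DecidableEq S] {deg : S → ℤ}

/-! ## §4 The projector `π = α⁻¹(E F + F E)` -/

/-- **Identities of the projector `π = α⁻¹(EF + FE)`** (weight `1`, degrees in `{0,1}`, `X ∈ 𝔥`, and
`[E, F] = α(2P − 1) + ζ₀` with `α ≠ 0`, `ζ₀ ∈ 𝔷_ℂ`): `E F E = αE`, `F E F = αF`, `π² = π`, `Pπ = πP`, `Eπ = E = πE`,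
`Fπ = F = πF`, `E F = α Pπ`, `F E = α(π − Pπ)`, `π = 1 + α⁻¹ζ₀(2P − 1)`, `ζ₀π = 0 = πζ₀`.  All follow from the corners
`E F = αP + ζ₀P`, `F E = α(1−P) − ζ₀(1−P)` and `ζ₀E = ζ₀F = 0` (`corners_of_commutator_eq`).
[cite: FultonHarris1991, Lecture 11 (§11.1)] [cite: MoonenZarhin1999LowDim, §2] -/
theorem projector_identities (H : HodgeStructure V n) (hn : n = 1) (e : Module.Basis S ℂ (ℂ ⊗[ℚ] V))
    (hF : ∀ a, H.F a = Submodule.span ℂ (e '' {σ | a ≤ deg σ}))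
    (hFc : ∀ a, complexConj (H.F a) = Submodule.span ℂ (e '' {σ | deg σ ≤ n - a}))
    (hdeg : ∀ σ, deg σ = 0 ∨ deg σ = 1) {X : Module.End ℚ V} (hX : X ∈ H.hodgeLie) {α : ℂ} (hα : α ≠ 0)
    {ζ₀ : Module.End ℂ (ℂ ⊗[ℚ] V)} (hζ₀ : ζ₀ ∈ spanC (H.hodgeLie ⊓ Subalgebra.toSubmodule H.endAlg))
    (hEF : (gradingEnd e deg * X.baseChange ℂ * (1 - gradingEnd e deg)) *
          ((1 - gradingEnd e deg) * X.baseChange ℂ * gradingEnd e deg) -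
        ((1 - gradingEnd e deg) * X.baseChange ℂ * gradingEnd e deg) *
          (gradingEnd e deg * X.baseChange ℂ * (1 - gradingEnd e deg)) =
        α • ((2 : ℂ) • gradingEnd e deg - 1) + ζ₀)
    {Q : Module.End ℂ (ℂ ⊗[ℚ] V)}
    (hQ : Q = α⁻¹ • ((gradingEnd e deg * X.baseChange ℂ * (1 - gradingEnd e deg)) *
          ((1 - gradingEnd e deg) * X.baseChange ℂ * gradingEnd e deg) +
        ((1 - gradingEnd e deg) * X.baseChange ℂ * gradingEnd e deg) *
          (gradingEnd e deg * X.baseChange ℂ * (1 - gradingEnd e deg)))) :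
    (gradingEnd e deg * X.baseChange ℂ * (1 - gradingEnd e deg)) *
          ((1 - gradingEnd e deg) * X.baseChange ℂ * gradingEnd e deg) *
          (gradingEnd e deg * X.baseChange ℂ * (1 - gradingEnd e deg)) =
        α • (gradingEnd e deg * X.baseChange ℂ * (1 - gradingEnd e deg)) ∧
      ((1 - gradingEnd e deg) * X.baseChange ℂ * gradingEnd e deg) *
          (gradingEnd e deg * X.baseChange ℂ * (1 - gradingEnd e deg)) *
          ((1 - gradingEnd e deg) * X.baseChange ℂ * gradingEnd e deg) =
        α • ((1 - gradingEnd e deg) * X.baseChange ℂ * gradingEnd e deg) ∧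
      Q * Q = Q ∧ gradingEnd e deg * Q = Q * gradingEnd e deg ∧
      (gradingEnd e deg * X.baseChange ℂ * (1 - gradingEnd e deg)) * Q =
        gradingEnd e deg * X.baseChange ℂ * (1 - gradingEnd e deg) ∧
      Q * (gradingEnd e deg * X.baseChange ℂ * (1 - gradingEnd e deg)) =
        gradingEnd e deg * X.baseChange ℂ * (1 - gradingEnd e deg) ∧
      ((1 - gradingEnd e deg) * X.baseChange ℂ * gradingEnd e deg) * Q =
        (1 - gradingEnd e deg) * X.baseChange ℂ * gradingEnd e deg ∧
      Q * ((1 - gradingEnd e deg) * X.baseChange ℂ * gradingEnd e deg) =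
        (1 - gradingEnd e deg) * X.baseChange ℂ * gradingEnd e deg ∧
      (gradingEnd e deg * X.baseChange ℂ * (1 - gradingEnd e deg)) *
          ((1 - gradingEnd e deg) * X.baseChange ℂ * gradingEnd e deg) = α • (gradingEnd e deg * Q) ∧
      ((1 - gradingEnd e deg) * X.baseChange ℂ * gradingEnd e deg) *
          (gradingEnd e deg * X.baseChange ℂ * (1 - gradingEnd e deg)) = α • (Q - gradingEnd e deg * Q) ∧
      Q = 1 + α⁻¹ • (ζ₀ * ((2 : ℂ) • gradingEnd e deg - 1)) ∧ ζ₀ * Q = 0 ∧ Q * ζ₀ = 0 := by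
  classical
  subst hn
  obtain ⟨hEFc, hFEc, hζE, hζF, hsum⟩ := corners_of_commutator_eq H rfl e hF hFc hdeg hX hζ₀ hEF
  set P := gradingEnd e deg with hP
  set Y := X.baseChange ℂ with hY
  set E := P * Y * (1 - P) with hEdef
  set F := (1 - P) * Y * P with hFdef
  have hPP : P * P = P := gradingEnd_mul_gradingEnd_of_deg e hdeg
  have hPE : P * E = E := by rw [hEdef, ← mul_assoc, ← mul_assoc, hPP]
  have hEP : E * P = 0 := by rw [hEdef, mul_assoc (P * Y) (1 - P) P, sub_mul, one_mul, hPP, sub_self, mul_zero]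
  have hPF : P * F = 0 := by
    rw [hFdef, mul_assoc (1 - P) Y P, ← mul_assoc P (1 - P) (Y * P), mul_sub, mul_one, hPP, sub_self, zero_mul]
  have hFP : F * P = F := by rw [hFdef, mul_assoc ((1 - P) * Y) P P, hPP]
  have hEQ : E * (1 - P) = E := by rw [mul_sub, mul_one, hEP, sub_zero]
  have hQF : (1 - P) * F = F := by rw [sub_mul, one_mul, hPF, sub_zero]
  have hYM : Y ∈ H.hodgeLieC := H.baseChange_mem_hodgeLieC hX
  obtain ⟨hEM, hFM⟩ := projE_mem_hodgeLieC H e hF hFc hdeg hYM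
  rw [← hP, ← hEdef] at hEM
  rw [← hP, ← hFdef] at hFM
  have hζP : ζ₀ * P = P * ζ₀ := commute_gradingEnd_of_mem_spanC_center H rfl e hF hFc hζ₀
  have hζEc : ζ₀ * E = E * ζ₀ := commute_of_mem_spanC_center H hζ₀ hEM
  have hζFc : ζ₀ * F = F * ζ₀ := commute_of_mem_spanC_center H hζ₀ hFM
  obtain ⟨hEE, hFF⟩ := SL2Triple.mul_self_eq_zero hPE hEP hPF hFP
  -- `E F E = α E`, `F E F = α F`
  have hEFE : E * F * E = α • E := by
    rw [hEFc, add_mul, smul_mul_assoc, hPE, mul_assoc ζ₀ P E, hPE, hζE, add_zero]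
  have hFEF : F * E * F = α • F := by
    rw [hFEc, sub_mul, smul_mul_assoc, hQF, mul_assoc ζ₀ (1 - P) F, hQF, hζF, sub_zero]
  -- the projector
  have hQdef : Q = α⁻¹ • (E * F + F * E) := hQ
  have h1 : E * F * (E * F) = α • (E * F) := by rw [← mul_assoc (E * F) E F, hEFE, smul_mul_assoc]
  have h2 : E * F * (F * E) = 0 := by rw [← mul_assoc (E * F) F E, mul_assoc E F F, hFF, mul_zero, zero_mul]
  have h3 : F * E * (E * F) = 0 := by rw [← mul_assoc (F * E) E F, mul_assoc F E E, hEE, mul_zero, zero_mul]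
  have h4 : F * E * (F * E) = α • (F * E) := by rw [← mul_assoc (F * E) F E, hFEF, smul_mul_assoc]
  have hQQ : Q * Q = Q := by
    calc Q * Q = (α⁻¹ * α⁻¹) • ((E * F + F * E) * (E * F + F * E)) := by rw [hQdef, smul_mul_smul_comm]
      _ = (α⁻¹ * α⁻¹) • (α • (E * F) + α • (F * E)) := by
          simp only [mul_add, add_mul, h1, h2, h3, h4, add_zero, zero_add]
      _ = Q := by rw [← smul_add, smul_smul, mul_assoc, inv_mul_cancel₀ hα, mul_one, hQdef]
  have hPQ' : P * Q = α⁻¹ • (E * F) := by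
    rw [hQdef, mul_smul_comm, mul_add, ← mul_assoc P E F, hPE, ← mul_assoc P F E, hPF, zero_mul, add_zero]
  have hQP' : Q * P = α⁻¹ • (E * F) := by
    rw [hQdef, smul_mul_assoc, add_mul, mul_assoc E F P, hFP, mul_assoc F E P, hEP, mul_zero, add_zero]
  have hPQ : P * Q = Q * P := by rw [hPQ', hQP']
  have hEQ' : E * Q = E := by
    rw [hQdef, mul_smul_comm, mul_add, ← mul_assoc E E F, hEE, zero_mul, zero_add, ← mul_assoc E F E, hEFE, smul_smul,
      inv_mul_cancel₀ hα, one_smul]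
  have hQE : Q * E = E := by
    rw [hQdef, smul_mul_assoc, add_mul, hEFE, mul_assoc F E E, hEE, mul_zero, add_zero, smul_smul, inv_mul_cancel₀ hα,
      one_smul]
  have hFQ' : F * Q = F := by
    rw [hQdef, mul_smul_comm, mul_add, ← mul_assoc F E F, hFEF, ← mul_assoc F F E, hFF, zero_mul, add_zero, smul_smul,
      inv_mul_cancel₀ hα, one_smul]
  have hQF' : Q * F = F := by
    rw [hQdef, smul_mul_assoc, add_mul, mul_assoc E F F, hFF, mul_zero, zero_add, hFEF, smul_smul, inv_mul_cancel₀ hα,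
      one_smul]
  have hEF' : E * F = α • (P * Q) := by rw [hPQ', smul_smul, mul_inv_cancel₀ hα, one_smul]
  have hFE' : F * E = α • (Q - P * Q) := by
    have h : Q - P * Q = α⁻¹ • (F * E) := by rw [hPQ', hQdef, smul_add, add_sub_cancel_left]
    rw [h, smul_smul, mul_inv_cancel₀ hα, one_smul]
  have hQ1 : Q = 1 + α⁻¹ • (ζ₀ * ((2 : ℂ) • P - 1)) := by
    rw [hQdef, hsum, smul_add, smul_smul, inv_mul_cancel₀ hα, one_smul]
  have hζQ : ζ₀ * Q = 0 := by
    rw [hQdef, mul_smul_comm, mul_add, ← mul_assoc ζ₀ E F, hζE, zero_mul, ← mul_assoc ζ₀ F E, hζF, zero_mul, add_zero,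
      smul_zero]
  have hQζ : Q * ζ₀ = 0 := by
    rw [hQdef, smul_mul_assoc, add_mul, mul_assoc E F ζ₀, ← hζFc, ← mul_assoc E ζ₀ F, ← hζEc, hζE, zero_mul,
      mul_assoc F E ζ₀, ← hζEc, ← mul_assoc F ζ₀ E, ← hζFc, hζF, zero_mul, add_zero, smul_zero]
  exact ⟨hEFE, hFEF, hQQ, hPQ, hEQ', hQE, hFQ', hQF', hEF', hFE', hQ1, hζQ, hQζ⟩

/-- **`D² ∈ ℂ·π` for every `D ∈ 𝔡_ℂ`** (`dim_ℚ 𝔡 = 3`, `π = α⁻¹(EF + FE)`): `D = aE + bF + c[E,F]`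
(`exists_coeffs_of_mem_spanC_derived`) and `E² = F² = 0`, `[E,F]E = αE = −E[E,F]`, `[E,F]F = −αF = −F[E,F]`,
`EF + FE = απ`, `[E,F]² = α²π`, whence `D² = α(ab + αc²)π`.  (On `range π ≅ W₁ ⊗ std` every element of `𝔡_ℂ ≅ 𝔰𝔩₂` acts
as `1 ⊗ M` with `M` trace-free, and `M² = −det M`.) [cite: FultonHarris1991, Lecture 11 (§11.1)] [cite: MoonenZarhin1999LowDim, §2] -/
theorem sq_eq_smul_projector (H : HodgeStructure V n) (ψ : H.Polarization) (hn : n = 1)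
    (e : Module.Basis S ℂ (ℂ ⊗[ℚ] V)) (hF : ∀ a, H.F a = Submodule.span ℂ (e '' {σ | a ≤ deg σ}))
    (hFc : ∀ a, complexConj (H.F a) = Submodule.span ℂ (e '' {σ | deg σ ≤ n - a}))
    (hdeg : ∀ σ, deg σ = 0 ∨ deg σ = 1) {X : Module.End ℚ V} (hX : X ∈ H.hodgeLie) (hXE : X ∉ H.endAlg)
    (h3 : Module.finrank ℚ ↥(Submodule.span ℚ {B | ∃ X ∈ H.hodgeLie, ∃ Y ∈ H.hodgeLie, X * Y - Y * X = B}) = 3)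
    {α : ℂ} (hα : α ≠ 0) {ζ₀ : Module.End ℂ (ℂ ⊗[ℚ] V)}
    (hζ₀ : ζ₀ ∈ spanC (H.hodgeLie ⊓ Subalgebra.toSubmodule H.endAlg))
    (hEF : (gradingEnd e deg * X.baseChange ℂ * (1 - gradingEnd e deg)) *
          ((1 - gradingEnd e deg) * X.baseChange ℂ * gradingEnd e deg) -
        ((1 - gradingEnd e deg) * X.baseChange ℂ * gradingEnd e deg) *
          (gradingEnd e deg * X.baseChange ℂ * (1 - gradingEnd e deg)) =
        α • ((2 : ℂ) • gradingEnd e deg - 1) + ζ₀)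
    {Q : Module.End ℂ (ℂ ⊗[ℚ] V)}
    (hQ : Q = α⁻¹ • ((gradingEnd e deg * X.baseChange ℂ * (1 - gradingEnd e deg)) *
          ((1 - gradingEnd e deg) * X.baseChange ℂ * gradingEnd e deg) +
        ((1 - gradingEnd e deg) * X.baseChange ℂ * gradingEnd e deg) *
          (gradingEnd e deg * X.baseChange ℂ * (1 - gradingEnd e deg))))
    {D : Module.End ℂ (ℂ ⊗[ℚ] V)}
    (hD : D ∈ spanC (Submodule.span ℚ {B | ∃ X ∈ H.hodgeLie, ∃ Y ∈ H.hodgeLie, X * Y - Y * X = B})) :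
    ∃ μ : ℂ, D * D = μ • Q := by
  classical
  subst hn
  obtain ⟨hEFE, hFEF, -, -, -, -, -, -, -, -, -, -, -⟩ := projector_identities H rfl e hF hFc hdeg hX hα hζ₀ hEF hQ
  obtain ⟨c, hc⟩ := exists_coeffs_of_mem_spanC_derived H ψ rfl e hF hFc hdeg hX hXE h3 hD
  set P := gradingEnd e deg with hP
  set Y := X.baseChange ℂ with hY
  set E := P * Y * (1 - P) with hEdef
  set F := (1 - P) * Y * P with hFdef
  have hPP : P * P = P := gradingEnd_mul_gradingEnd_of_deg e hdeg
  have hPE : P * E = E := by rw [hEdef, ← mul_assoc, ← mul_assoc, hPP]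
  have hEP : E * P = 0 := by rw [hEdef, mul_assoc (P * Y) (1 - P) P, sub_mul, one_mul, hPP, sub_self, mul_zero]
  have hPF : P * F = 0 := by
    rw [hFdef, mul_assoc (1 - P) Y P, ← mul_assoc P (1 - P) (Y * P), mul_sub, mul_one, hPP, sub_self, zero_mul]
  have hFP : F * P = F := by rw [hFdef, mul_assoc ((1 - P) * Y) P P, hPP]
  obtain ⟨hEE, hFF⟩ := SL2Triple.mul_self_eq_zero hPE hEP hPF hFP
  set B := E * F - F * E with hBdef
  have hsumQ : E * F + F * E = α • Q := by rw [hQ, smul_smul, mul_inv_cancel₀ hα, one_smul]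
  have hBE : B * E = α • E := by rw [hBdef, sub_mul, hEFE, mul_assoc F E E, hEE, mul_zero, sub_zero]
  have hEB : E * B = -(α • E) := by rw [hBdef, mul_sub, ← mul_assoc E E F, hEE, zero_mul, zero_sub, ← mul_assoc, hEFE]
  have hBF : B * F = -(α • F) := by rw [hBdef, sub_mul, mul_assoc E F F, hFF, mul_zero, zero_sub, hFEF]
  have hFB : F * B = α • F := by rw [hBdef, mul_sub, ← mul_assoc F F E, hFF, zero_mul, sub_zero, ← mul_assoc, hFEF]
  have hBB : B * B = (α * α) • Q := by
    have h : B * B = E * F * (E * F) - E * F * (F * E) - (F * E * (E * F) - F * E * (F * E)) := by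
      rw [hBdef, sub_mul, mul_sub, mul_sub]
    rw [h, ← mul_assoc (E * F) E F, hEFE, ← mul_assoc (E * F) F E, mul_assoc E F F, hFF, mul_zero, zero_mul, sub_zero,
      ← mul_assoc (F * E) E F, mul_assoc F E E, hEE, mul_zero, zero_mul, zero_sub, ← mul_assoc (F * E) F E, hFEF,
      smul_mul_assoc, smul_mul_assoc, sub_neg_eq_add, ← smul_add, hsumQ, smul_smul]
  refine ⟨(c 0 * c 1) * α + (c 2 * c 2) * (α * α), ?_⟩
  rw [hc]
  simp only [mul_add, add_mul, smul_mul_assoc, mul_smul_comm, hEE, hFF, hBE, hEB, hBF, hFB, hBB, smul_zero, zero_add,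
    add_zero, smul_neg]
  have hEFQ : E * F = α • Q - F * E := by rw [← hsumQ, add_sub_cancel_right]
  rw [hEFQ]
  module

/-! ## §5 The projector is rational: `π = p_ℂ` with `p ∈ ℚ·B²`, `B ∈ 𝔡` -/

/-- **`π = α⁻¹(EF + FE)` is the complexification of a rational idempotent `p = q⁻¹B²` with `B ∈ 𝔡`, `q ∈ ℚˣ`**;
`p ≠ 0` is a Hodge endomorphism commuting with `𝔥` and with `End_Hdg(V)`, `ψ`-symmetric, and `D p = D = p D` for
every `D ∈ 𝔡` (weight `1`,
effective, `ψ` a polarization, `X ∈ 𝔥 ∖ End_Hdg(V)`, `dim_ℚ 𝔡 = 3`).  PROOF: some `B ∈ 𝔡` has `B² ≠ 0` — otherwise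
`DD' = −D'D` on `𝔡`, so the trace form vanishes on `𝔡`, against `hodgeLie_derived_trace_separating`; then
`B_ℂ² = λπ` (`sq_eq_smul_projector`), `λ ≠ 0`, `B⁴ = λB²` forces `λ ∈ ℚ` (`exists_ratCast_eq_of_baseChange_eq_smul`), and
the identities of `π` descend (`eq_zero_of_baseChange_eq_zero`). [cite: MoonenZarhin1999LowDim, §2]
[cite: Deligne1982HodgeCycles, I §3 (3.1–3.7)] [cite: FultonHarris1991, Lecture 11 (§11.1)] -/
theorem exists_rat_projector (H : HodgeStructure V n) (ψ : H.Polarization) (hn : n = 1) (heff : H.IsEffective)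
    (e : Module.Basis S ℂ (ℂ ⊗[ℚ] V)) (hF : ∀ a, H.F a = Submodule.span ℂ (e '' {σ | a ≤ deg σ}))
    (hFc : ∀ a, complexConj (H.F a) = Submodule.span ℂ (e '' {σ | deg σ ≤ n - a}))
    (hdeg : ∀ σ, deg σ = 0 ∨ deg σ = 1) {X : Module.End ℚ V} (hX : X ∈ H.hodgeLie) (hXE : X ∉ H.endAlg)
    (h3 : Module.finrank ℚ ↥(Submodule.span ℚ {B | ∃ X ∈ H.hodgeLie, ∃ Y ∈ H.hodgeLie, X * Y - Y * X = B}) = 3)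
    {α : ℂ} (hα : α ≠ 0) {ζ₀ : Module.End ℂ (ℂ ⊗[ℚ] V)}
    (hζ₀ : ζ₀ ∈ spanC (H.hodgeLie ⊓ Subalgebra.toSubmodule H.endAlg))
    (hEF : (gradingEnd e deg * X.baseChange ℂ * (1 - gradingEnd e deg)) *
          ((1 - gradingEnd e deg) * X.baseChange ℂ * gradingEnd e deg) -
        ((1 - gradingEnd e deg) * X.baseChange ℂ * gradingEnd e deg) *
          (gradingEnd e deg * X.baseChange ℂ * (1 - gradingEnd e deg)) =
        α • ((2 : ℂ) • gradingEnd e deg - 1) + ζ₀)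
    {Q : Module.End ℂ (ℂ ⊗[ℚ] V)}
    (hQ : Q = α⁻¹ • ((gradingEnd e deg * X.baseChange ℂ * (1 - gradingEnd e deg)) *
          ((1 - gradingEnd e deg) * X.baseChange ℂ * gradingEnd e deg) +
        ((1 - gradingEnd e deg) * X.baseChange ℂ * gradingEnd e deg) *
          (gradingEnd e deg * X.baseChange ℂ * (1 - gradingEnd e deg)))) :
    ∃ p : Module.End ℚ V, p.baseChange ℂ = Q ∧ p * p = p ∧ p ≠ 0 ∧
      (∃ B ∈ Submodule.span ℚ {B | ∃ X ∈ H.hodgeLie, ∃ Y ∈ H.hodgeLie, X * Y - Y * X = B}, ∃ q : ℚ,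
        q ≠ 0 ∧ p = q⁻¹ • (B * B)) ∧
      p ∈ H.endAlg ∧ (∀ W ∈ H.hodgeLie, W * p = p * W) ∧ (∀ a ∈ H.endAlg, a * p = p * a) ∧
      (∀ D ∈ Submodule.span ℚ {B | ∃ X ∈ H.hodgeLie, ∃ Y ∈ H.hodgeLie, X * Y - Y * X = B}, D * p = D ∧ p * D = D) ∧
      (∀ v w, ψ.form (p v) w = ψ.form v (p w)) := by
  classical
  subst hn
  set 𝔡 := Submodule.span ℚ {B | ∃ X ∈ H.hodgeLie, ∃ Y ∈ H.hodgeLie, X * Y - Y * X = B} with h𝔡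
  obtain ⟨hEFE, -, hQQ, hPQ, hEQ', hQE, hFQ', hQF', -, -, -, -, -⟩ :=
    projector_identities H rfl e hF hFc hdeg hX hα hζ₀ hEF hQ
  obtain ⟨hE0, -⟩ := projE_ne_zero_of_not_mem_endAlg H rfl e hF hFc hdeg hXE
  set P := gradingEnd e deg with hP
  set Y := X.baseChange ℂ with hY
  set E := P * Y * (1 - P) with hEdef
  set F := (1 - P) * Y * P with hFdef
  have hPP : P * P = P := gradingEnd_mul_gradingEnd_of_deg e hdeg
  have h𝔡le : 𝔡 ≤ H.hodgeLie := by
    refine Submodule.span_le.2 ?_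
    rintro _ ⟨X₁, hX₁, X₂, hX₂, rfl⟩
    exact H.commutator_mem_hodgeLie hX₁ hX₂
  -- some `B ∈ 𝔡` with `B² ≠ 0`
  obtain ⟨B, hB𝔡, hBB0⟩ : ∃ B ∈ 𝔡, B * B ≠ 0 := by
    by_contra hall
    push Not at hall
    have hzero : ∀ D ∈ 𝔡, D = 0 := by
      intro D hD
      refine hodgeLie_derived_trace_separating H rfl heff ψ hD fun D' hD' => ?_
      have hsq : (D + D') * (D + D') = 0 := hall _ (𝔡.add_mem hD hD')
      rw [add_mul, mul_add, mul_add, hall D hD, hall D' hD', zero_add, add_zero] at hsq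
      have hDD' : D * D' = -(D' * D) := eq_neg_of_add_eq_zero_left hsq
      have htr : LinearMap.trace ℚ V (D * D') = -LinearMap.trace ℚ V (D * D') := by
        conv_lhs => rw [hDD', map_neg, LinearMap.trace_mul_comm]
      linarith
    have hbot : 𝔡 = ⊥ := by
      rw [Submodule.eq_bot_iff]
      exact hzero
    rw [hbot, finrank_bot] at h3
    exact absurd h3 (by norm_num)
  -- `B_ℂ² = λ π`, `λ ≠ 0`, `λ ∈ ℚ`
  have hBC : B.baseChange ℂ ∈ spanC 𝔡 := baseChange_mem_spanC hB𝔡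
  obtain ⟨μ, hμ⟩ := sq_eq_smul_projector H ψ rfl e hF hFc hdeg hX hXE h3 hα hζ₀ hEF hQ hBC
  have hBBC : (B * B).baseChange ℂ = μ • Q := by rw [LinearMap.baseChange_mul, hμ]
  have hμ0 : μ ≠ 0 := by
    intro h0
    rw [h0, zero_smul] at hBBC
    exact hBB0 (eq_zero_of_baseChange_eq_zero hBBC)
  have hB4 : (B * B * (B * B)).baseChange ℂ = μ • (B * B).baseChange ℂ := by
    rw [LinearMap.baseChange_mul, hBBC, smul_mul_smul_comm, hQQ, mul_smul]
  obtain ⟨q, hq⟩ := exists_ratCast_eq_of_baseChange_eq_smul hBB0 hB4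
  have hq0 : q ≠ 0 := by
    rintro rfl
    exact hμ0 (by rw [← hq, Rat.cast_zero])
  set p : Module.End ℚ V := q⁻¹ • (B * B) with hpdef
  have hpQ : p.baseChange ℂ = Q := by
    rw [hpdef, baseChange_ratCast_smul, hBBC, smul_smul, Rat.cast_inv, hq, inv_mul_cancel₀ hμ0, one_smul]
  have hpp : p * p = p := by
    have h : (p * p - p).baseChange ℂ = 0 := by rw [LinearMap.baseChange_sub, LinearMap.baseChange_mul, hpQ, hQQ, sub_self]
    exact sub_eq_zero.1 (eq_zero_of_baseChange_eq_zero h)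
  have hp0 : p ≠ 0 := by
    intro h0
    apply hE0
    rw [← hEQ', ← hpQ, h0, LinearMap.baseChange_zero, mul_zero]
  -- `p` is a Hodge endomorphism commuting with `𝔥`
  have hpA : p ∈ H.endAlg := by
    have hc : p.baseChange ℂ * P = P * p.baseChange ℂ := by rw [hpQ, hPQ]
    exact mem_endAlg_of_projE_eq_zero H e hF hdeg (blocks_D hPP hc).1 (blocks_D hPP hc).2
  have hpcomm : ∀ W ∈ H.hodgeLie, W * p = p * W := fun W hW => commute_of_mem_hodgeLie H hW ⟨p, hpA⟩
  have hpcA : ∀ a ∈ H.endAlg, a * p = p * a := by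
    intro a ha
    have hBa : B * a = a * B := commute_of_mem_hodgeLie H (h𝔡le hB𝔡) ⟨a, ha⟩
    rw [hpdef, mul_smul_comm, smul_mul_assoc, ← mul_assoc, ← hBa, mul_assoc, ← hBa, ← mul_assoc]
  -- `D p = D = p D` on `𝔡`
  have hDp : ∀ D ∈ 𝔡, D * p = D ∧ p * D = D := by
    intro D hD
    obtain ⟨c, hc⟩ := exists_coeffs_of_mem_spanC_derived H ψ rfl e hF hFc hdeg hX hXE h3 (baseChange_mem_spanC hD)
    rw [← hP, ← hY, ← hEdef, ← hFdef] at hc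
    have hBQ : (E * F - F * E) * Q = E * F - F * E := by rw [sub_mul, mul_assoc E F Q, hFQ', mul_assoc F E Q, hEQ']
    have hQB : Q * (E * F - F * E) = E * F - F * E := by rw [mul_sub, ← mul_assoc Q E F, hQE, ← mul_assoc Q F E, hQF']
    constructor
    · apply sub_eq_zero.1
      apply eq_zero_of_baseChange_eq_zero
      rw [LinearMap.baseChange_sub, LinearMap.baseChange_mul, hpQ, hc]
      simp only [add_mul, smul_mul_assoc, hEQ', hFQ', hBQ, sub_self]
    · apply sub_eq_zero.1
      apply eq_zero_of_baseChange_eq_zero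
      rw [LinearMap.baseChange_sub, LinearMap.baseChange_mul, hpQ, hc]
      simp only [mul_add, mul_smul_comm, hQE, hQF', hQB, sub_self]
  -- `ψ`-symmetry
  have hBskew : ∀ v w, ψ.form (B v) w + ψ.form v (B w) = 0 :=
    fun v w => form_apply_add_eq_zero_of_mem_hodgeLie ψ (h𝔡le hB𝔡) v w
  have hpsymm : ∀ v w, ψ.form (p v) w = ψ.form v (p w) := by
    intro v w
    have h1 : ψ.form (B (B v)) w = ψ.form v (B (B w)) := by
      have ha := hBskew (B v) w
      have hb := hBskew v (B w)
      linarith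
    simp only [hpdef, LinearMap.smul_apply, Module.End.mul_apply, map_smul, smul_eq_mul, h1]
  exact ⟨p, hpQ, hpp, hp0, ⟨B, hB𝔡, q, hq0, rfl⟩, hpA, hpcomm, hpcA, hDp, hpsymm⟩

end HodgeStructure

end Literature.AlgebraicGeometry.Motives

end
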